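import Literature.MathematicalPhysics.QuantumFieldTheory.Balaban1983to89.Node00.Record13Ax

/-!
# NODE 00 — [Ax-3b] of WORK ORDER RC-1 (director-ym №462 (B)∕№463∕№467 (ii) «L-gen»; CRIT-1 g33 RULING Q-3 (iii) «parametrised re-issue taking the
# centre as an ARGUMENT»): the Stage-13 β-layer chain of `Node00/Record13` §1–§5 RE-ISSUED GENERIC IN THE β-SLOT χ — `betaOfRecord₁₃Chi`, `gOfRecord₁₃Chi`,
# `EOfRecord₁₃Chi`, …, `coreOfRecord₁₃Chi`, `Stage13Params.Provisos₁₃Chi`, `towerOfRecord₁₃Chi`, `datumOfRecord₁₃Chi` — with the receipts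
# «instance at `χ := chiβOfRecord₁₃ θ` = the record, definitionally» and the Ax instances at `χ := chiβOfRecord₁₃Ax θ`

CITATION HEADER.  [I] = [Balaban1987RG1] (CMP **109**), (0.17)–(0.20) pp.255–256, (1.20)–(1.22) p.264, (2.3) p.265, (2.9) p.266; [III] = [Balaban1988Convergent]
(CMP 119) (2.18) p.257, Thm 1 p.262; [IV] = [Balaban1989LargeFieldI] (0.2)–(0.4) p.176.  Every declaration below is the VERBATIM body of the like-named
declaration of `Node00/Record13.lean` (K0⁷ record, def-T FILE 28, lines 186–569 and 718–824) with EXACTLY these substitutions: a parameter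
`(χ : ChiSlot F N)` = `(K : ℕ) → (ℕ → ℝ) → (k : ℕ) → Density (F.P K) k (SU N)` after `θ`; `betaOfRecord₁₃ F N θ ↦ betaOfRecord₁₃Chi F N θ χ :=
betaOfRecord₈Tχ F N (TβOfRecord₁₃ F N) χ θ.toStage8Params`; `chiβOfRecord₁₃ F N θ ↦ χ`; every re-issued name `X ↦ XChi` (theorems `↦ …_chi`); the `zetaMeas`
autoParam default dropped (the field stays, REQUIRED).  NOTHING of record is edited (body-freeze №460 (2)); the record IS the instance `χ := chiβOfRecord₁₃ θ` BY
`rfl` (§R), and the re-centred record of RC-1 is the instance `χ := chiβOfRecord₁₃Ax θ` (§A; [Ax-2] ✓p796675, [Ax-3a] ✓p797092).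

WHY.  CRIT-1 Q-3 «CHOICE CHANNEL» (porter PT-A-2's located reading, UPHELD): the (2.9) cut-off of record is centred at `Ū^k(Classical.choose …)`; every value read
through `chiβOfRecord₁₃` depends on the choice; the repair re-centres at print's block-axial representative.  Director-ym №467 (ii) chose the CENTRE-GENERIC
re-issue (one χ-generic chain, two instances) over a fork; this file is its Record13 layer (hands: porter PT-A-2; custodians node00 def-Y∕def-T∕K0e).  The CoPH ∕
SepCoPH(V) layers ([Ax-3c]∕[Ax-3d]) follow the same recipe.
HONEST FRAMING.  Definitions re-issued over a parameter + `rfl`∕`Iff` receipts; the [B11]∕[III] provisos stay HYPOTHESES; nothing of Bałaban's asserted, ported or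
discharged; K0⁷∕K1⁹∕K3⁸ AS VETTED read the choice-centred cut-off (to be banked aside per №467 (i)); no `sorry`∕`instance`∕`notation`; standard axioms; the YM mass
gap (Clay) is NOT proved by any of this.
-/

noncomputable section

open MeasureTheory
open scoped Matrix.Norms.L2Operator

namespace Literature.MathematicalPhysics.QuantumFieldTheory.Balaban1983to89.Node00

open T4Continuum AveragingRT T4FiniteEpsInhabited FlowStep FlowStepRuns DagBinding T4DatumAssembly
open B12Eq019ActionBody (integrand)

variable (F : T4Family) (N : ℕ) [NeZero N]

/-! ## §0. The β-slot type and the χ-generic β -/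

/-- The TYPE of the β-slot χ of the Stage-13 record (the type of `chiβOfRecord₁₃ θ`, of def-χ's `chiFixed7∕chiFixed29` and of [Ax-2]'s `chiFixed29Ax`):
per torus, per coupling sequence, per level, a density on the step field. [cite: Balaban1987RG1, (0.19) p.255 and (2.9) p.266] -/
abbrev ChiSlot : Type _ := (K : ℕ) → (ℕ → ℝ) → (k : ℕ) → Density (F.P K) k (SU N)

/-- **THE β-FUNCTIONS, χ-GENERIC**: def-B's χ-generic β over the β-layer transport of record at an ARBITRARY β-slot χ — `betaOfRecord₁₃ θ` is the instance
`χ := chiβOfRecord₁₃ θ` (`rfl`), `betaOfRecord₁₃Ax θ` the instance `χ := chiβOfRecord₁₃Ax θ` (`rfl`). [cite: Balaban1987RG1, (1.20)–(1.22) p.264] -/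
abbrev betaOfRecord₁₃Chi (θ : Stage13Params F N) (χ : ChiSlot F N) : HBeta :=
  betaOfRecord₈Tχ F N (TβOfRecord₁₃ F N) χ θ.toStage8Params

/-! ## §1–§5. The chain of `Node00/Record13` §1–§5, χ-generic (verbatim bodies; see the module docstring for the substitution list) -/


/-- The GENERATED HISTORY of the run `p` at Stage 13: `g_k := genSeq β₁₃ g₀ k`. [cite: Balaban1987RG1, (0.17)–(0.20) pp.255–256] -/
abbrev gOfRecord₁₃Chi (θ : Stage13Params F N) (χ : ChiSlot F N) (p : B12.RunParams) : ℕ → ℝ :=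
  genSeq (betaOfRecord₁₃Chi F N θ χ) p.g0

/-- The normalisation `E(p)` of `ρ₀` at Stage 13 = Stage 8's `EOfRecord` along the ₁₃ histories. [cite: Balaban1988Convergent, (1.15) p.249 and Thm 1 p.262 (bookkeeping)] -/
abbrev EOfRecord₁₃Chi (θ : Stage13Params F N) (χ : ChiSlot F N) : B12.RunParams → ℝ :=
  EOfRecord F N θ.ν θ.Efl θ.logz (fun p => genSeq (betaOfRecord₁₃Chi F N θ χ) p.g0)

/-- **`rep_k` of record, Stage 13** along the run `p` (FILE 2's `repOfRecord9` at the ₁₃ plugs). [cite: Balaban1988Convergent, (2.18) p.257] -/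
def reprOfRecord₁₃Chi (θ : Stage13Params F N) (χ : ChiSlot F N) (p : B12.RunParams) (k : ℕ) : Step.Repr218 (F.P p.K) (SU N) k :=
  repOfRecord9 F N θ.ν θ.τ9 (EOfRecord₁₃Chi F N θ χ) (wOfRecord₉ F N θ.toStage9Params) θ.ppSel p (gOfRecord₁₃Chi F N θ χ p) k

/-- **`Tstep rep_k` of record, Stage 13**. [cite: Balaban1988Convergent, (3.25) p.270] -/
def reprTOfRecord₁₃Chi (θ : Stage13Params F N) (χ : ChiSlot F N) (p : B12.RunParams) (k : ℕ) : Step.Repr218 (F.P p.K) (SU N) (k + 1) :=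
  repTOfRecord9 F N θ.ν θ.τ9 (EOfRecord₁₃Chi F N θ χ) (wOfRecord₉ F N θ.toStage9Params) θ.ppSel p (gOfRecord₁₃Chi F N θ χ p) k

/-- **`ρ_k := eval rep_k`** — THE DENSITY OF RECORD at Stage 13. [cite: Balaban1988Convergent, (2.18) p.257 and (0.2) p.244] -/
def densOfRecord₁₃Chi (θ : Stage13Params F N) (χ : ChiSlot F N) (p : B12.RunParams) (k : ℕ) : Density (F.P p.K) k (SU N) :=
  rhoOfRecord9 F N θ.ν θ.τ9 (EOfRecord₁₃Chi F N θ χ) (wOfRecord₉ F N θ.toStage9Params) θ.ppSel p (gOfRecord₁₃Chi F N θ χ p) k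

/-- **`𝐓ρ_k := eval (Tstep rep_k)`** — the T-stepped density of record, Stage 13. [cite: Balaban1988Convergent, (3.1) p.264 and (3.25) p.270] -/
def tdensOfRecord₁₃Chi (θ : Stage13Params F N) (χ : ChiSlot F N) (p : B12.RunParams) (k : ℕ) : Density (F.P p.K) (k + 1) (SU N) :=
  trhoOfRecord9 F N θ.ν θ.τ9 (EOfRecord₁₃Chi F N θ χ) (wOfRecord₉ F N θ.toStage9Params) θ.ppSel p (gOfRecord₁₃Chi F N θ χ p) k

/-- (2.18) holds for `ρ_k` with `rep_k` of record, BY CONSTRUCTION. [cite: Balaban1988Convergent, (2.18) p.257 (bookkeeping)] -/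
theorem holds_densOfRecord₁₃_chi (θ : Stage13Params F N) (χ : ChiSlot F N) (p : B12.RunParams) (k : ℕ) :
    (reprOfRecord₁₃Chi F N θ χ p k).Holds (densOfRecord₁₃Chi F N θ χ p k) :=
  holds_repOfRecord9 F N θ.ν θ.τ9 _ _ θ.ppSel p _ k

/-- (2.18) holds for `𝐓ρ_k` with `Tstep rep_k` of record, BY CONSTRUCTION. [cite: Balaban1988Convergent, (3.25) p.270 (bookkeeping)] -/
theorem holds_tdensOfRecord₁₃_chi (θ : Stage13Params F N) (χ : ChiSlot F N) (p : B12.RunParams) (k : ℕ) :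
    (reprTOfRecord₁₃Chi F N θ χ p k).Holds (tdensOfRecord₁₃Chi F N θ χ p k) :=
  holds_repTOfRecord9 F N θ.ν θ.τ9 _ _ θ.ppSel p _ k

/-- `ρ₀` of record is the Wilson start at the run's bare coupling. [cite: Balaban1988Convergent, Thm 1 p.262] -/
theorem densOfRecord₁₃_zero_chi (θ : Stage13Params F N) (χ : ChiSlot F N) (p : B12.RunParams) :
    densOfRecord₁₃Chi F N θ χ p 0 = rhoZeroOfRecord F N p.K p.g0 (EOfRecord₁₃Chi F N θ χ p) := by
  rw [densOfRecord₁₃Chi, rhoOfRecord9_zero]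
  exact congrArg (fun x => rhoZeroOfRecord F N p.K x (EOfRecord₁₃Chi F N θ χ p)) (genSeq_zero _ _)

/-- `ρ_{k+1}` of record IS the slice density of def-R's R-stepped pre-𝐑 slot (`rfl`). [cite: Balaban1989LargeFieldI, (0.3) p.176 (bookkeeping)] -/
theorem densOfRecord₁₃_succ_chi (θ : Stage13Params F N) (χ : ChiSlot F N) (p : B12.RunParams) (k : ℕ) :
    densOfRecord₁₃Chi F N θ χ p (k + 1)
      = densityOfSlice F N θ.ν θ.τ9.M p (gOfRecord₁₃Chi F N θ χ p) (k + 1)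
          (rstepSlotOfRecord F N θ.ν θ.τ9 θ.ppSel p (gOfRecord₁₃Chi F N θ χ p) (k + 1)
            (slotsTOfRecord F N θ.ν θ.τ9 (EOfRecord₁₃Chi F N θ χ) (wOfRecord₉ F N θ.toStage9Params) θ.ppSel p (gOfRecord₁₃Chi F N θ χ p) (k + 1))) := rfl

/-! ## §2. The Stage-12-keyed run objects along the ₁₃ histories: 𝐓-weights, setting, background maps, support of record -/

/-- **THE 𝐓-WEIGHTS OF RECORD OF THE RUN `p`, Stage 13** — 12a's `tkWeightsOfRecord` along the ₁₃ history over the residual part `θ.Zt p.K`.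
[cite: Balaban1988Convergent, (2.21) p.258, (3.16) p.268, (3.21) p.269, (3.3) p.265, (2.10) p.256] -/
def WtOfRecord₁₃Chi (θ : Stage13Params F N) (χ : ChiSlot F N) (p : B12.RunParams) : TkWeights F N (FluctV N) p.K :=
  tkWeightsOfRecord F N (FluctV N) θ.ν θ.A₁ θ.s2.cR p (gOfRecord₁₃Chi F N θ χ p) (θ.Zt p.K)

variable {F N} in
/-- 11a's weight laws hold for the Stage-13 weights of record under 12a's residual law. [cite: Balaban1988Convergent, (2.21) p.258] -/
theorem WtOfRecord₁₃_laws_chi {θ : Stage13Params F N} {χ : ChiSlot F N} (hZ : ∀ K, (θ.Zt K).Laws) (p : B12.RunParams) : (WtOfRecord₁₃Chi F N θ χ p).Laws :=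
  tkWeightsOfRecord_laws (hZ p.K)

variable {F N} in
/-- The radii of record are positive along a ₁₃ history in the window (FILE 12b's `alphaPos₁₂_of_window`). [cite: Balaban1988Convergent, (2.28) p.259] -/
theorem alphaPos₁₃_of_inInterval_chi {θ : Stage13Params F N} {χ : ChiSlot F N} (hθ : θ.Admissible F N) {p : B12.RunParams} {n : ℕ}
    (hw : Step.InInterval θ.γ n (gOfRecord₁₃Chi F N θ χ p)) {j : ℕ} (hj : j ≤ n) :
    0 < (lfOfRecord₁₂ F N θ.toStage12Params).alpha0 (gOfRecord₁₃Chi F N θ χ p j) ∧ 0 < (lfOfRecord₁₂ F N θ.toStage12Params).alpha1 (gOfRecord₁₃Chi F N θ χ p j) :=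
  alphaPos₁₂_of_window hθ.1 (hw j hj).1 (hw j hj).2

/-- **THE §2 SETTING OF RECORD of the run `p`, Stage 13** — as FILE 12b's with the flow of the run along `gOfRecord₁₃Chi`.
[cite: Balaban1987RG1, pp.251–252, (1.12) p.262, (0.20) p.256; Balaban1988Convergent, (2.28) p.259, (2.34)–(2.39) p.261] -/
def settingOfRecord₁₃Chi (θ : Stage13Params F N) (χ : ChiSlot F N) (p : B12.RunParams) : Sect2.Setting (MatA N) (SU N) where
  𝓜 := B12RegularSpaces111SpecialUnitary.suModel N
  ι := ιSU N
  cB := θ.s2.cB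
  βc := θ.s2.βc
  B := θ.s2.B
  C := θ.s2.C
  Mr := θ.s2.Mr
  lf := lfOfRecord₁₂ F N θ.toStage12Params
  flow := flowOfRun (gOfRecord₁₃Chi F N θ χ p)

/-- 11b's model provisos discharged by construction. [cite: Balaban1987RG1, pp.251–252, (1.10)–(1.11) p.262] -/
theorem settingOfRecord₁₃_laws_chi (θ : Stage13Params F N) (χ : ChiSlot F N) (p : B12.RunParams) : (settingOfRecord₁₃Chi F N θ χ p).Laws :=
  ⟨fun U => ιSU_mem_G N U, B12RegularSpaces111SpecialUnitary.suModel_G_le_Gc⟩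

/-- The setting's sign conditions ARE the numerics'. [cite: Balaban1988Convergent, (2.34)–(2.39) p.261 (bookkeeping)] -/
theorem settingOfRecord₁₃_pos_chi (θ : Stage13Params F N) (χ : ChiSlot F N) (hθ : θ.s2.Pos) (p : B12.RunParams) : (settingOfRecord₁₃Chi F N θ χ p).Pos :=
  ⟨hθ.1, hθ.2.1, hθ.2.2.1, hθ.2.2.2⟩

/-- The setting's flow satisfies the RG equations at every index. [cite: Balaban1987RG1, (0.20) p.256] -/
theorem settingOfRecord₁₃_satisfiesRG_chi (θ : Stage13Params F N) (χ : ChiSlot F N) (p : B12.RunParams) (k : ℕ) : (settingOfRecord₁₃Chi F N θ χ p).flow.SatisfiesRG k :=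
  flowOfRun_satisfiesRG _ k

/-- The setting's couplings ARE the ₁₃ history (`rfl`). [cite: Balaban1987RG1, (0.17)–(0.20) pp.255–256 (bookkeeping)] -/
theorem settingOfRecord₁₃_flow_g_chi (θ : Stage13Params F N) (χ : ChiSlot F N) (p : B12.RunParams) :
    (settingOfRecord₁₃Chi F N θ χ p).flow.g = gOfRecord₁₃Chi F N θ χ p := rfl

/-- The setting's term constants ARE `lfOfRecord₁₂` (`rfl`). [cite: Balaban1988Convergent, (2.28) p.259 (bookkeeping)] -/
theorem settingOfRecord₁₃_lf_chi (θ : Stage13Params F N) (χ : ChiSlot F N) (p : B12.RunParams) : (settingOfRecord₁₃Chi F N θ χ p).lf = lfOfRecord₁₂ F N θ.toStage12Params := rfl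

/-- **THE BACKGROUND MAPS OF RECORD, Stage 13** — FILE 12b's two-case carrier along the ₁₃ history: level 0 the print's `U₀(𝐖) := 𝐖 0`, level `n+1` def-R's
`UbgMSOfRecord` (print's multi-scale class). [cite: Balaban1988Convergent, Thm 1 p.262, (2.12)–(2.13) pp.256–257; Balaban1985AveragingOps, (6)∕(8) p.278] -/
def UbgOfRecord₁₃Chi (θ : Stage13Params F N) (χ : ChiSlot F N) (p : B12.RunParams) :
    (n : ℕ) → (SeqOfRecord F θ.ν θ.τ9.M (gOfRecord₁₃Chi F N θ χ p) p.K n → BgMap F N p.K)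
  | 0 => fun _ W => W 0
  | n + 1 => UbgMSOfRecord F N θ.ν θ.τ9.M (gOfRecord₁₃Chi F N θ χ p) p.K (n + 1)

/-- LEVEL 0: the background map of record IS the scale-0 field (`rfl`). [cite: Balaban1988Convergent, Thm 1 p.262] -/
theorem UbgOfRecord₁₃_zero_chi (θ : Stage13Params F N) (χ : ChiSlot F N) (p : B12.RunParams) : UbgOfRecord₁₃Chi F N θ χ p 0 = fun _ W => W 0 := rfl

/-- LEVEL `n + 1`: def-R's multi-scale background map of record (`rfl`). [cite: Balaban1988Convergent, (2.12)–(2.13) pp.256–257] -/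
theorem UbgOfRecord₁₃_succ_chi (θ : Stage13Params F N) (χ : ChiSlot F N) (p : B12.RunParams) (n : ℕ) :
    UbgOfRecord₁₃Chi F N θ χ p (n + 1) = UbgMSOfRecord F N θ.ν θ.τ9.M (gOfRecord₁₃Chi F N θ χ p) p.K (n + 1) := rfl

/-- **THE SUPPORT OF RECORD** of the background proviso, Stage 13 (def-R's `regSuppOfRecord` at `cR` along the ₁₃ history). [cite: Balaban1988Convergent, (2.10) p.256, (2.28) p.259] -/
def suppOfRecord₁₃Chi (θ : Stage13Params F N) (χ : ChiSlot F N) (p : B12.RunParams) (n : ℕ) :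
    SeqOfRecord F θ.ν θ.τ9.M (gOfRecord₁₃Chi F N θ χ p) p.K n → Set (B15DeterminingSets.MSField (F.P p.K) (SU N)) :=
  regSuppOfRecord F N θ.ν θ.τ9.M (gOfRecord₁₃Chi F N θ χ p) p.K n θ.s2.cR

/-- The regular support contains the unit configuration at an admissible θ whenever the radii `ε_j` are positive. [cite: Balaban1988Convergent, (2.10) p.256] -/
theorem one_mem_suppOfRecord₁₃_chi (θ : Stage13Params F N) (χ : ChiSlot F N) (hθ : θ.Pos₁₂ F N) (p : B12.RunParams) (n : ℕ)
    (hε : ∀ j ≤ n, 0 < epsOfRecord θ.ν (gOfRecord₁₃Chi F N θ χ p) j)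
    (s : SeqOfRecord F θ.ν θ.τ9.M (gOfRecord₁₃Chi F N θ χ p) p.K n) :
    (1 : B15DeterminingSets.MSField (F.P p.K) (SU N)) ∈ suppOfRecord₁₃Chi F N θ χ p n s :=
  one_mem_regSuppOfRecord F N θ.ν θ.τ9.M (gOfRecord₁₃Chi F N θ χ p) p.K n hθ.1 hε s

/-! ## §3. The two pins, the carriers, the residual, the view, the core — Stage 13 -/

/-- **THE §2 [III] FORMAT PREDICATE OF RECORD, Stage 13** for step-`j` densities of the run `p`: represented by `rep_j` of record AND the post-𝐑 slot family of record
has the REPAIRED §2 form at index `j` — at the ₁₃ setting, weights, background maps and slots. [cite: Balaban1988Convergent, (2.17)–(2.18) p.257, (2.23)–(2.42) pp.258–261, Thm 1 p.262] -/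
def S218OfRecord₁₃Chi (θ : Stage13Params F N) (χ : ChiSlot F N) (p : B12.RunParams) (j : ℕ) (σ : Density (F.P p.K) j (SU N)) : Prop :=
  (reprOfRecord₁₃Chi F N θ χ p j).Holds σ ∧
    HasSect2FormAEZ F N (FluctV N) p.K (settingOfRecord₁₃Chi F N θ χ p) (θ.Rz p.K) (WtOfRecord₁₃Chi F N θ χ p) j
      (UbgOfRecord₁₃Chi F N θ χ p j)
      (slotsOfRecord F N θ.ν θ.τ9 (EOfRecord₁₃Chi F N θ χ) (wOfRecord₉ F N θ.toStage9Params) θ.ppSel p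
        (gOfRecord₁₃Chi F N θ χ p) j)

/-- **THE «CORRESPONDING SPACE» PREDICATE OF RECORD, Stage 13** for the 𝐓-image at step `k+1`. [cite: Balaban1988Convergent, remark p.262, Def. p.279, (3.25) p.270] -/
def ScorrLawOfRecord₁₃Chi (θ : Stage13Params F N) (χ : ChiSlot F N) (p : B12.RunParams) (k : ℕ) (σ' : Density (F.P p.K) (k + 1) (SU N)) : Prop :=
  (reprTOfRecord₁₃Chi F N θ χ p k).Holds σ' ∧
    HasSect2FormTAEZ F N (FluctV N) p.K (settingOfRecord₁₃Chi F N θ χ p) (θ.Rz p.K) (WtOfRecord₁₃Chi F N θ χ p) k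
      (UbgOfRecord₁₃Chi F N θ χ p (k + 1))
      (slotsTOfRecord F N θ.ν θ.τ9 (EOfRecord₁₃Chi F N θ χ) (wOfRecord₉ F N θ.toStage9Params) θ.ppSel p
        (gOfRecord₁₃Chi F N θ χ p) (k + 1))

/-- **`SLaw₁₃Chi θ p j`** — `S218OfRecord₁₃Chi` READ AT `densOfRecord₁₃Chi`. [cite: Balaban1988Convergent, (2.18) p.257, Thm 1 p.262] -/
def SLaw₁₃Chi (θ : Stage13Params F N) (χ : ChiSlot F N) (p : B12.RunParams) (j : ℕ) : Prop :=
  S218OfRecord₁₃Chi F N θ χ p j (densOfRecord₁₃Chi F N θ χ p j)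

/-- **`TLaw₁₃Chi θ p k`** — `ScorrLawOfRecord₁₃Chi` READ AT `tdensOfRecord₁₃Chi`. [cite: Balaban1988Convergent, remark p.262, Def. p.279] -/
def TLaw₁₃Chi (θ : Stage13Params F N) (χ : ChiSlot F N) (p : B12.RunParams) (k : ℕ) : Prop :=
  ScorrLawOfRecord₁₃Chi F N θ χ p k (tdensOfRecord₁₃Chi F N θ χ p k)

/-- `SLaw₁₃Chi` IS the repaired §2 form of the post-𝐑 slot family (the representation clause holds by construction). [cite: Balaban1988Convergent, (2.18) p.257, Thm 1 p.262] -/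
theorem sLaw₁₃_iff_chi (θ : Stage13Params F N) (χ : ChiSlot F N) (p : B12.RunParams) (j : ℕ) :
    SLaw₁₃Chi F N θ χ p j ↔ HasSect2FormAEZ F N (FluctV N) p.K (settingOfRecord₁₃Chi F N θ χ p) (θ.Rz p.K) (WtOfRecord₁₃Chi F N θ χ p) j
      (UbgOfRecord₁₃Chi F N θ χ p j)
      (slotsOfRecord F N θ.ν θ.τ9 (EOfRecord₁₃Chi F N θ χ) (wOfRecord₉ F N θ.toStage9Params) θ.ppSel p
        (gOfRecord₁₃Chi F N θ χ p) j) :=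
  ⟨fun h => h.2, fun h => ⟨holds_densOfRecord₁₃_chi F N θ χ p j, h⟩⟩

/-- `TLaw₁₃Chi` IS the repaired 𝐓-image form of the pre-𝐑 slot family. [cite: Balaban1988Convergent, remark p.262, (3.25) p.270] -/
theorem tLaw₁₃_iff_chi (θ : Stage13Params F N) (χ : ChiSlot F N) (p : B12.RunParams) (k : ℕ) :
    TLaw₁₃Chi F N θ χ p k ↔ HasSect2FormTAEZ F N (FluctV N) p.K (settingOfRecord₁₃Chi F N θ χ p) (θ.Rz p.K) (WtOfRecord₁₃Chi F N θ χ p) k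
      (UbgOfRecord₁₃Chi F N θ χ p (k + 1))
      (slotsTOfRecord F N θ.ν θ.τ9 (EOfRecord₁₃Chi F N θ χ) (wOfRecord₉ F N θ.toStage9Params) θ.ppSel p
        (gOfRecord₁₃Chi F N θ χ p) (k + 1)) :=
  ⟨fun h => h.2, fun h => ⟨holds_tdensOfRecord₁₃_chi F N θ χ p k, h⟩⟩

/-- **THE BASE IS A THEOREM** at Stage 13: the level-0 post-𝐑 slot family HAS the repaired §2 form for EVERY `θ` and run — n13-e's GENERIC
`hasSect2FormAE_zero_of_bg_readsScaleZero` (any setting whose flow starts at `g 0`, any background map reading the scale-0 variables), identity branch.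
[cite: Balaban1988Convergent, Thm 1 p.262, (2.18) p.257, (2.23)–(2.24) pp.258–259] -/
theorem sLaw₁₃_zero_chi (θ : Stage13Params F N) (χ : ChiSlot F N) (p : B12.RunParams) : SLaw₁₃Chi F N θ χ p 0 :=
  (sLaw₁₃_iff_chi F N θ χ p 0).mpr
    (B16Thm1BaseAtRecord11.hasSect2FormAE_zero_of_bg_readsScaleZero F N (FluctV N) p (settingOfRecord₁₃Chi F N θ χ p) (θ.Rz p.K)
      (WtOfRecord₁₃Chi F N θ χ p) θ.ν θ.τ9 (EOfRecord₁₃Chi F N θ χ) (wOfRecord₉ F N θ.toStage9Params) θ.ppSel rfl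
      (U := UbgOfRecord₁₃Chi F N θ χ p 0) (fun _ _ => rfl)).toZ

/-- … so at level 0 the format predicate of record IS the representation clause. [cite: Balaban1988Convergent, Thm 1 p.262, (2.18) p.257 (bookkeeping)] -/
theorem s218OfRecord₁₃_zero_iff_chi (θ : Stage13Params F N) (χ : ChiSlot F N) (p : B12.RunParams) (σ : Density (F.P p.K) 0 (SU N)) :
    S218OfRecord₁₃Chi F N θ χ p 0 σ ↔ (reprOfRecord₁₃Chi F N θ χ p 0).Holds σ :=
  ⟨fun h => h.1, fun h => ⟨h, (sLaw₁₃_zero_chi F N θ χ p).2⟩⟩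

/-- **ABSENT SLOTS PASS**: if every post-𝐑 slot of record at level `j` is the zero function, `SLaw₁₃Chi θ p j` holds under the signs `0 ≤ E₀, B₀` and a nonnegative
history up to `j`. [cite: Balaban1988Convergent, (2.17) p.257; Balaban1987RG1, (0.20) p.256] -/
theorem sLaw₁₃_of_forall_slot_eq_zero_chi (θ : Stage13Params F N) (χ : ChiSlot F N) (p : B12.RunParams) (j : ℕ)
    (h0 : ∀ s, slotsOfRecord F N θ.ν θ.τ9 (EOfRecord₁₃Chi F N θ χ) (wOfRecord₉ F N θ.toStage9Params) θ.ppSel p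
      (gOfRecord₁₃Chi F N θ χ p) j s = 0)
    (hE₀ : 0 ≤ θ.s2.lf.E₀) (hB₀ : 0 ≤ θ.s2.lf.B₀) (hg : ∀ i, i ≤ j → 0 ≤ gOfRecord₁₃Chi F N θ χ p i) : SLaw₁₃Chi F N θ χ p j :=
  (sLaw₁₃_iff_chi F N θ χ p j).mpr
    (hasSect2FormAEZ_of_forall_eq_zero p.K _ _ _ j _ h0 (settingOfRecord₁₃_satisfiesRG_chi F N θ χ p j) hE₀ hB₀ hg)

/-- **THE 𝐑-CARRIERS OF THE RUN `p`, Stage 13**: target space `S j ρ :↔ ρ = ρ_j ∧ SLaw₁₃Chi θ p j`, corresponding space `Scorr (k+1) ρ' :↔ ρ' = 𝐓ρ_k ∧ TLaw₁₃Chi θ p k`,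
`Scorr 0 :≡ ⊥`, induced `R`. [cite: Balaban1988Convergent, p.244 and remark p.262; Balaban1989LargeFieldI, (0.2)–(0.3) p.176] -/
def VOfRecord₁₃Chi (θ : Stage13Params F N) (χ : ChiSlot F N) (p : B12.RunParams) : PrintedCarriers14R where
  P := F.P p.K
  G := SU N
  instGG := inferInstance
  instMS := inferInstance
  instHD := inferInstance
  K := p.K
  R := fun k => inducedAt (tdensOfRecord₁₃Chi F N θ χ p k) (densOfRecord₁₃Chi F N θ χ p (k + 1))
  Scorr := fun j ρ' => match j with
    | 0 => False
    | k + 1 => ρ' = tdensOfRecord₁₃Chi F N θ χ p k ∧ TLaw₁₃Chi F N θ χ p k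
  S := fun j ρ => ρ = densOfRecord₁₃Chi F N θ χ p j ∧ SLaw₁₃Chi F N θ χ p j

/-- The pinned density operation maps `𝐓ρ_k ↦ ρ_{k+1}`. [cite: Balaban1989LargeFieldI, (0.2)–(0.3) p.176 (bookkeeping)] -/
theorem R_VOfRecord₁₃_tdens_chi (θ : Stage13Params F N) (χ : ChiSlot F N) (p : B12.RunParams) (k : ℕ) :
    (VOfRecord₁₃Chi F N θ χ p).R k (tdensOfRecord₁₃Chi F N θ χ p k) = densOfRecord₁₃Chi F N θ χ p (k + 1) :=
  inducedAt_self _ _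

/-- **[III] p. 244's LEAF AT THE STAGE-13 CARRIERS**: `ROpLeaf (VOfRecord₁₃Chi θ p) ↔ ∀ k < K, TLaw₁₃Chi θ p k → SLaw₁₃Chi θ p (k+1)`.
[cite: Balaban1988Convergent, p.244, Thm 2 p.263 and remark p.262 (bookkeeping)] -/
theorem rOpLeaf_VOfRecord₁₃_iff_chi (θ : Stage13Params F N) (χ : ChiSlot F N) (p : B12.RunParams) :
    ROpLeaf (VOfRecord₁₃Chi F N θ χ p) ↔ ∀ k, k < p.K → TLaw₁₃Chi F N θ χ p k → SLaw₁₃Chi F N θ χ p (k + 1) := by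
  rw [rOpLeaf_iff]
  refine ⟨fun h k hk hT => ?_, fun h k hk ρ' hρ' => ?_⟩
  · have hS := h k hk (tdensOfRecord₁₃Chi F N θ χ p k) ⟨rfl, hT⟩
    rw [R_VOfRecord₁₃_tdens_chi] at hS
    exact hS.2
  · obtain ⟨rfl, hT⟩ := hρ'
    show (VOfRecord₁₃Chi F N θ χ p).S (k + 1) ((VOfRecord₁₃Chi F N θ χ p).R k (tdensOfRecord₁₃Chi F N θ χ p k))
    rw [R_VOfRecord₁₃_tdens_chi]
    exact ⟨rfl, h k hk hT⟩

/-- **THE STAGE-13 RESIDUAL**: Stage 8's residual with the 𝐑-carriers `VOfRecord₁₃Chi`, the β RE-POINT `βfun := betaOfRecord₁₃` (the χ-generic β at `TcanOfRecord` and the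
(2.9) species), `E`, `χ := chiβOfRecord₁₃ θ` along `gOfRecord₁₃Chi`, the four action∕format fields over def-B's transport-generic layer AT `TβOfRecord₁₃ = TcanOfRecord`
and `chiβOfRecord₁₃ θ`, and `S218 := S218OfRecord₁₃Chi` PINNED.
[cite: Balaban1988Convergent, p.244, (2.18) p.257; Balaban1989LargeFieldI, (0.2)–(0.6) pp.176–177; Balaban1987RG1, (0.19) p.255, p.259 (dictionary; bookkeeping)] -/
def residualOfStage13Chi (θ : Stage13Params F N) (χ : ChiSlot F N) : Residual₅ F N :=
  { residualOfStage8 F N θ.toStage8Params with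
    V := VOfRecord₁₃Chi F N θ χ
    βfun := betaOfRecord₁₃Chi F N θ χ
    χ := fun p k => χ p.K (gOfRecord₁₃Chi F N θ χ p) k
    E := EOfRecord₁₃Chi F N θ χ
    effAction := effActionOfRecordT F N (TβOfRecord₁₃ F N) (χ) (betaOfRecord₁₃Chi F N θ χ)
    Ek := EkOfRecordT F N (TβOfRecord₁₃ F N) (χ) θ.εbg (betaOfRecord₁₃Chi F N θ χ)
    ReprA := ReprAOfRecordT F N (TβOfRecord₁₃ F N) (χ) θ.εbg (betaOfRecord₁₃Chi F N θ χ)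
    IndA := IndAOfRecordT F N (TβOfRecord₁₃ F N) (χ) θ.εbg (betaOfRecord₁₃Chi F N θ χ)
    S218 := S218OfRecord₁₃Chi F N θ χ }

/-- **The Stage-5 VIEW of Stage-13 parameters, Stage-13 residual**. [cite: Balaban1989LargeFieldII, Thm 1 p.355 (bookkeeping)] -/
def Stage13Params.toStage5₁₃Chi (θ : Stage13Params F N) (χ : ChiSlot F N) : Stage5Params F N :=
  { θ.toStage5Params with res := residualOfStage13Chi F N θ χ }

/-- The view's 𝐑-carriers ARE the pinned ones (`rfl`). [cite: Balaban1988Convergent, p.244 (bookkeeping)] -/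
theorem Stage13Params.toStage5₁₃_res_V_chi (θ : Stage13Params F N) (χ : ChiSlot F N) (p : B12.RunParams) : (θ.toStage5₁₃Chi F N χ).res.V p = VOfRecord₁₃Chi F N θ χ p := rfl

/-- The view's format slot IS the Stage-13 predicate of record (`rfl`). [cite: Balaban1988Convergent, (2.18) p.257 (bookkeeping)] -/
theorem Stage13Params.toStage5₁₃_res_S218_chi (θ : Stage13Params F N) (χ : ChiSlot F N) : (θ.toStage5₁₃Chi F N χ).res.S218 = S218OfRecord₁₃Chi F N θ χ := rfl

/-- The view's β-functions ARE `betaOfRecord₁₃ θ` (`rfl`). [cite: Balaban1987RG1, (1.20)–(1.22) p.264 (bookkeeping)] -/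
theorem Stage13Params.toStage5₁₃_res_βfun_chi (θ : Stage13Params F N) (χ : ChiSlot F N) : (θ.toStage5₁₃Chi F N χ).res.βfun = betaOfRecord₁₃Chi F N θ χ := rfl

/-- **THE RECORD'S 𝐑-LEAF, UNFOLDED** at the C-binding of record over the Stage-13 view. [cite: Balaban1988Convergent, p.244 and Thm 2 p.263; Balaban1989LargeFieldII, Thm 1 p.355 (bookkeeping)] -/
theorem rOperation_upOfRecord₅C_stage13_iff_chi (θ : Stage13Params F N) (χ : ChiSlot F N) (p : B12.RunParams) :
    (upOfRecord₅C F N (θ.toStage5₁₃Chi F N χ) p).rOperation ↔ ∀ k, k < p.K → TLaw₁₃Chi F N θ χ p k → SLaw₁₃Chi F N θ χ p (k + 1) := by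
  show ROpLeaf (VOfRecord₁₃Chi F N θ χ p) ↔ _
  exact rOpLeaf_VOfRecord₁₃_iff_chi F N θ χ p

/-- **THE CORE OF RECORD at `θ`, Stage 13** (`RGMachineCore`, by hand, as FILE 10's `coreOfRecord₁₀` with `TcOfRecord ↦ TβOfRecord₁₃ = TcanOfRecord`, `chiFixed7 ↦ chiβOfRecord₁₃ θ = chiFixed29 θ.ν θ.ε₂₉` and the ₁₃ plugs):
`Sect2Form p k := S218OfRecord₁₃Chi θ p k ρ_k` READ AT `densOfRecord₁₃Chi`. [cite: Balaban1987RG1, (0.17)–(0.24) pp.255–257, p.259; Balaban1988Convergent, (2.17)–(2.18) p.257, Thm 1 p.262 (dictionary; bookkeeping)] -/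
def coreOfRecord₁₃Chi (θ : Stage13Params F N) (χ : ChiSlot F N) : RGMachineCore F (SU N) where
  βfun := betaOfRecord₁₃Chi F N θ χ
  E := EOfRecord₁₃Chi F N θ χ
  dom := fun p k => domAltOfRecord F N θ.ν p.K k
  effAction := effActionOfRecordT F N (TβOfRecord₁₃ F N) (χ) (betaOfRecord₁₃Chi F N θ χ)
  wilsonBG := wilsonBGOfRecord F N θ.εbg
  Ek := EkOfRecordT F N (TβOfRecord₁₃ F N) (χ) θ.εbg (betaOfRecord₁₃Chi F N θ χ)
  χ := fun p k => χ p.K (gOfRecord₁₃Chi F N θ χ p) k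
  Repr := fun p k => ReprAOfRecordT F N (TβOfRecord₁₃ F N) (χ) θ.εbg (betaOfRecord₁₃Chi F N θ χ) p k
    (prefixOf (gOfRecord₁₃Chi F N θ χ p) k) (domAltOfRecord F N θ.ν p.K k)
    (effActionOfRecordT F N (TβOfRecord₁₃ F N) (χ) (betaOfRecord₁₃Chi F N θ χ) p k)
    (wilsonBGOfRecord F N θ.εbg p k) (EkOfRecordT F N (TβOfRecord₁₃ F N) (χ) θ.εbg (betaOfRecord₁₃Chi F N θ χ) p k)
  IndAss := fun p k => IndAOfRecordT F N (TβOfRecord₁₃ F N) (χ) θ.εbg (betaOfRecord₁₃Chi F N θ χ) p k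
    (prefixOf (gOfRecord₁₃Chi F N θ χ p) k) (domAltOfRecord F N θ.ν p.K k)
    (effActionOfRecordT F N (TβOfRecord₁₃ F N) (χ) (betaOfRecord₁₃Chi F N θ χ) p k)
    (wilsonBGOfRecord F N θ.εbg p k) (EkOfRecordT F N (TβOfRecord₁₃ F N) (χ) θ.εbg (betaOfRecord₁₃Chi F N θ χ) p k)
  Sect2Form := fun p k => S218OfRecord₁₃Chi F N θ χ p k (densOfRecord₁₃Chi F N θ χ p k)

/-- The core's Wilson start IS `ρ₀` of record. [cite: Balaban1988Convergent, Thm 1 p.262 (bookkeeping)] -/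
theorem rhoZero_coreOfRecord₁₃_chi (θ : Stage13Params F N) (χ : ChiSlot F N) (p : B12.RunParams) :
    (coreOfRecord₁₃Chi F N θ χ).rhoZero p = densOfRecord₁₃Chi F N θ χ p 0 := by
  rw [densOfRecord₁₃_zero_chi]
  rfl

/-- The core's §2 clause IS `SLaw₁₃Chi` (`Iff.rfl`). [cite: Balaban1988Convergent, (2.18) p.257, Thm 1 p.262 (bookkeeping)] -/
theorem sect2Form_coreOfRecord₁₃_iff_chi (θ : Stage13Params F N) (χ : ChiSlot F N) (p : B12.RunParams) (k : ℕ) :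
    (coreOfRecord₁₃Chi F N θ χ).Sect2Form p k ↔ SLaw₁₃Chi F N θ χ p k := Iff.rfl

/-- The core's β IS the χ-generic β at the canonical-version transport and the (2.9) species (`rfl`). [cite: Balaban1987RG1, (1.20)–(1.22) p.264 (bookkeeping)] -/
theorem βfun_coreOfRecord₁₃_chi (θ : Stage13Params F N) (χ : ChiSlot F N) :
    (coreOfRecord₁₃Chi F N θ χ).βfun = betaOfRecord₈Tχ F N (TcanOfRecord F N) χ θ.toStage8Params := rfl

/-! ## §4. The displayed provisos of the Stage-13 record: FILE 12b's with the tower clauses re-read along the ₁₃ histories, `rstep` IN THE INTEGRABLE FORM, and NO transport-regularity field -/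

/-- **NON-DEGENERACY OF THE PRESENT SLOTS, NAMED, Stage 13** (NOT a proviso; FILE 12b's `SlotsNondegenerate` along the ₁₃ histories; `F N` explicit): every slot
of record at a sequence in the range of its level's selector is not the zero density.  Level 0 is never degenerate (`slotsNondegenerate₁₃_zero`, §6).
GUARDED BY THE TORUS exactly as FILE 12b v2.3 (director LINE №118, K0b LOCATED-R4): levels `k ≤ p.K` only — the range in which the tuple displays the slot's
construction (level `0` a theorem; levels `k + 1 ≤ K` by `rstep`); beyond `K` the unguarded text would read `Classical.choice` junk.
[cite: Balaban1988Convergent, (3.22) p.269; Balaban1989LargeFieldI, (0.3) p.176] -/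
def Stage13Params.SlotsNondegenerate₁₃Chi (θ : Stage13Params F N) (χ : ChiSlot F N) : Prop :=
  ∀ (p : B12.RunParams) (k : ℕ) (s : SeqOfRecord F θ.ν θ.τ9.M (gOfRecord₁₃Chi F N θ χ p) p.K k), k ≤ p.K →
    s ∈ Set.range (θ.ppSel p (gOfRecord₁₃Chi F N θ χ p) k) →
      slotsOfRecord F N θ.ν θ.τ9 (EOfRecord₁₃Chi F N θ χ) (wOfRecord₉ F N θ.toStage9Params) θ.ppSel p
        (gOfRecord₁₃Chi F N θ χ p) k s ≠ 0

/-- **DEPRECATED (v1.2, 2026-08-27 — director-ym №138 ∕ gate5 D-0009 deprecate-and-add; kept VERBATIM, append-only): row `bg` below is demanded over ALL (2.18) indices of the tree, including the NON-SEPARATED ones — print-stronger by exactly [6] (1.3)–(1.6) (`Sect2.SeqSeparated`); SUPERSEDED BY `Stage13Params.Provisos₁₃Sep` (§9: the same ten rows with `bg` over the separated support `suppOfRecord₁₃Sep` under the run guard `PartCompat₁₃`), to which every consumer re-points (`Provisos₁₃Chi.toSep`; bg-free core `Provisos₁₃Core`).**  **THE DISPLAYED PROVISOS at `θ : Stage13Params`,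 Stage 13** — FILE 12b's `Provisos₁₂` with the tower clauses of FILE 10's `Provisos₁₀` RE-READ ALONG THE
₁₃ HISTORIES (`intPiece`, `measω`, `measChi`; `zetaUnity`, `zetaAbs` history-free, verbatim), def-R's (0.3) provisos `rstep` RE-KEYED TO THE INTEGRABLE FORM
`RepData.ProvisosInt` (def-R `Node00/RStepProvisosIntOfRecord`: integrable pieces ∧ a.e. non-negativity ∧ the a.e. support clause — the form under which (0.4)
is a theorem, `integral_densityOfSlice_rstepSlotOfRecord_of_provisosInt`; the SUPPORT form's uniform bound and everywhere-support clause were over-strength of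
the form, not of print), and NO β-VERSION ∕ TRANSPORT-REGULARITY FIELD AT ALL (director LINE №128 D2 (i′): β reads the canonical-version transport
`TcanOfRecord`, §1); `rzLaws`, `ztLaws`, `ztLocal` verbatim; `bg` window-guarded along `gOfRecord₁₃Chi`.  Rows `intPiece` ∕ `measω` ∕ `measChi` ∕ `rstep` are
THEOREMS of the measurability hypothesis (H-U) `LocalBgMeasurable θ.ν` and the ζ-laws (§4c).  HYPOTHESES, never admissibility clauses, never asserted. [cite: Balaban1988Convergent, (2.7) p.255, (2.18) p.257, (2.21) p.258, (2.28) p.259, (3.2)–(3.9) pp.265–266, (3.16) p.268, (3.20)–(3.21) p.269; Balaban1989LargeFieldI, (0.3)–(0.4) p.176; Balaban1987RG1, (0.13) p.254, (0.19) p.255, p.259, (1.2) p.260] -/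
structure Stage13Params.Provisos₁₃Chi (θ : Stage13Params F N) (χ : ChiSlot F N) : Prop where
  /-- the level-`k` pieces `χ_k(s)·slot_k(s)` of `ρ_k` are integrable, `k < K`, along the ₁₃ histories -/
  intPiece : ∀ (p : B12.RunParams) (k : ℕ), k < p.K → ∀ s : SeqOfRecord F θ.ν θ.τ9.M (gOfRecord₁₃Chi F N θ χ p) p.K k,
    Integrable (fun U => chiSeqOfRecord F N θ.ν θ.τ9.M (gOfRecord₁₃Chi F N θ χ p) p.K k s U *
      slotsOfRecord F N θ.ν θ.τ9 (EOfRecord₁₃Chi F N θ χ) (wOfRecord₉ F N θ.toStage9Params) θ.ppSel p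
        (gOfRecord₁₃Chi F N θ χ p) k s U) (fieldMeasure (F.P p.K) k (SU N))
  /-- (O4): the label weights `ω = a·b·ζ` are jointly measurable in `(V′, U)`, `k < K`, along the ₁₃ histories -/
  measω : ∀ (p : B12.RunParams) (k : ℕ), k < p.K → ∀ (s : SeqOfRecord F θ.ν θ.τ9.M (gOfRecord₁₃Chi F N θ χ p) p.K k)
    (t : LbOfRecord F θ.ν p (gOfRecord₁₃Chi F N θ χ p) k),
    Measurable (fun z : GaugeField (F.P p.K) (k + 1) (SU N) × GaugeField (F.P p.K) k (SU N) =>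
      ωOfRecord F N θ.ν θ.τ9.M p (gOfRecord₁₃Chi F N θ χ p) k θ.A₁ θ.ζ s t z.2 z.1)
  /-- the new front factors `χ_{k+1}(s′)` are measurable, `k < K`, along the ₁₃ histories -/
  measChi : ∀ (p : B12.RunParams) (k : ℕ), k < p.K → ∀ s' : SeqOfRecord F θ.ν θ.τ9.M (gOfRecord₁₃Chi F N θ χ p) p.K (k + 1),
    Measurable (chiSeqOfRecord F N θ.ν θ.τ9.M (gOfRecord₁₃Chi F N θ χ p) p.K (k + 1) s')
  /-- the residual `ζ` resolves unity -/
  zetaUnity : IsZetaUnity F N θ.ν θ.τ9.M θ.ζ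
  /-- the residual `ζ` has `Σ |ζ| ≤ 1` -/
  zetaAbs : IsZetaAbsLeOne F N θ.ν θ.τ9.M θ.ζ
  /-- def-R's (0.3) provisos of the pre-𝐑 tower of record, INTEGRABLE FORM (`RepData.ProvisosInt`), at every level `k+1 ≤ K`, along the ₁₃ histories, at
  every instance -/
  rstep : ∀ (p : B12.RunParams) (k : ℕ) [DecidableEq (PBond (F.P p.K) (k + 1))], k < p.K →
    (towerRepOfRecord F N θ.ν θ.τ9 (slotsTOfRecord F N θ.ν θ.τ9 (EOfRecord₁₃Chi F N θ χ) (wOfRecord₉ F N θ.toStage9Params) θ.ppSel)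
      θ.ppSel p (gOfRecord₁₃Chi F N θ χ p) (k + 1)).toRepData.ProvisosInt
  /-- 11c's laws of the residual §2 data -/
  rzLaws : ∀ K, (θ.Rz K).Laws
  /-- 12a's law of the residual part of the 𝐓-weights: `ζ0 ≥ 0` -/
  ztLaws : ∀ K, (θ.Zt K).Laws
  /-- the locality law of the residual 𝐓-weight factor -/
  ztLocal : ∀ K, (θ.Zt K).LocalLaws
  /-- p. 259, ON PRINT'S RANGES (v1.1; def-R's `BgProvisoΛ`, `Node00/BgProvisoRangedOfRecord`): def-R's background of record lies in `U^c_j(X, α_{0,j}, α_{1,j})`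
  for the domains `X ⊂ Λ_j(s)` of the (2.26)–(2.27) ∕ (2.30) sums and in `Ũ^c_j(X)` for the domains of the (2.41)(i) range, on the regular retained
  configurations — every run whose ₁₃ history stays in the window `]0, γ]` up to the length `n ≤ K` -/
  bg : ∀ (p : B12.RunParams) (n : ℕ), n ≤ p.K → Step.InInterval θ.γ n (gOfRecord₁₃Chi F N θ χ p) →
    BgProvisoΛ F N p.K (settingOfRecord₁₃Chi F N θ χ p) (θ.Rz p.K) θ.τ9.M n (suppOfRecord₁₃Chi F N θ χ p n) (UbgOfRecord₁₃Chi F N θ χ p n)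
  /-- **(H-ζ) ROW** (v1.8 · director-ym №228 LOCATED-ζ · plan g87 S2-FULL): the residual fluctuation factor `ζ` of the record is jointly
  measurable in the old and new fields — the displayed bookkeeping proviso `ZetaMeasurable` (RECORD 12 measurability), until v1.7 threaded
  as a separate hypothesis `hζ`, now a ROW of every Stage-13 proviso edition.  A REAL, REQUIRED field (readers: `h.zetaMeas`); the `autoParam`
  default below only FILLS it at a construction site that omits it — from a Stage-13 proviso value of ANY edition already in hand (the
  transports ∕ doors) or from an `hζ` in context (the from-scratch selectors) — and fails loudly with the goal displayed otherwise.
  HYPOTHESIS, never an admissibility clause, never asserted. [cite: Balaban1988Convergent, (3.16) p.268, (3.20)–(3.21) p.269 (bookkeeping)] -/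
  zetaMeas : ZetaMeasurable F N θ.ζ

variable {F N}

/-- The weight laws of the run FROM the provisos. [cite: Balaban1988Convergent, (2.21) p.258 (bookkeeping)] -/
theorem Stage13Params.Provisos₁₃Chi.wtLaws {θ : Stage13Params F N} {χ : ChiSlot F N} (h : θ.Provisos₁₃Chi F N χ) (p : B12.RunParams) : (WtOfRecord₁₃Chi F N θ χ p).Laws :=
  WtOfRecord₁₃_laws_chi h.ztLaws p

/-- **def-T's step provisos FROM the Stage-13 provisos** at every step `k < K` (as FILE 10's `Provisos₁₀.tstep`, along the ₁₃ histories).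
[cite: Balaban1988Convergent, (3.2)–(3.9) pp.265–266, (3.16) p.268, (3.24)–(3.25) p.270] -/
theorem Stage13Params.Provisos₁₃Chi.tstep {θ : Stage13Params F N} {χ : ChiSlot F N} (h : θ.Provisos₁₃Chi F N χ) (p : B12.RunParams) (k : ℕ) (hk : k < p.K) :
    TStepProvisos F N θ.ν θ.τ9 (EOfRecord₁₃Chi F N θ χ) (wOfRecord₉ F N θ.toStage9Params) θ.ppSel p
      (gOfRecord₁₃Chi F N θ χ p) k where
  intPiece := h.intPiece p k hk
  measW := fun s' => measurable_wOfRecord F N θ.ν θ.τ9.M θ.A₁ θ.ζ p (gOfRecord₁₃Chi F N θ χ p) k (h.measω p k hk) s'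
  absW_le := fun s' U V' => abs_wOfRecord_le_one F N θ.ν θ.τ9.M θ.A₁ h.zetaAbs p (gOfRecord₁₃Chi F N θ χ p) k s' U V'
  measChi := h.measChi p k hk
  unity := isStepUnity_wOfRecord F N θ.ν θ.τ9.M θ.A₁ h.zetaUnity p (gOfRecord₁₃Chi F N θ χ p) k
variable (F N)

/-! ## §5. The tower and the datum of record, Stage 13; faces -/

/-- **(0.4) AT THE STEP along the ₁₃ histories, `∫ ρ_{k+1} = ∫ 𝐓ρ_k`, FROM THE INTEGRABLE-FORM `rstep`** (def-R's `integral_densityOfSlice_rstepSlotOfRecord_of_provisosInt`;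
instance-generic). [cite: Balaban1989LargeFieldI, (0.4) p.176] -/
theorem integral_densOfRecord₁₃_succ_chi (θ : Stage13Params F N) (χ : ChiSlot F N) (p : B12.RunParams) (k : ℕ) [DecidableEq (PBond (F.P p.K) (k + 1))]
    (hprov : (towerRepOfRecord F N θ.ν θ.τ9 (slotsTOfRecord F N θ.ν θ.τ9 (EOfRecord₁₃Chi F N θ χ) (wOfRecord₉ F N θ.toStage9Params) θ.ppSel)
      θ.ppSel p (gOfRecord₁₃Chi F N θ χ p) (k + 1)).toRepData.ProvisosInt) :
    ∫ V, densOfRecord₁₃Chi F N θ χ p (k + 1) V ∂(fieldMeasure (F.P p.K) (k + 1) (SU N))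
      = ∫ V, tdensOfRecord₁₃Chi F N θ χ p k V ∂(fieldMeasure (F.P p.K) (k + 1) (SU N)) := by
  rw [densOfRecord₁₃_succ_chi]
  exact integral_densityOfSlice_rstepSlotOfRecord_of_provisosInt F N θ.ν θ.τ9 _ θ.ppSel p _ (k + 1) hprov

open Classical in
/-- **THE TOWER OF RECORD at `θ` under its Stage-13 provisos**, BY HAND at the Stage-13 core (`RGMachineCore.Tower`'s five fields): `ρ := densOfRecord₁₃Chi`,
`Trho := tdensOfRecord₁₃Chi`; the Wilson start by `rhoZero_coreOfRecord₁₃_chi`; the push-forward obligation by def-T's `isRT_trhoOfRecord9` under the step provisos;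
(0.4) at the step by `integral_densOfRecord₁₃_succ_chi` under the INTEGRABLE-FORM `rstep` (at the classical instance). [cite: Balaban1988Convergent, (0.2) p.244, (2.18) p.257, (3.25) p.270; Balaban1989LargeFieldI, (0.4) p.176] -/
def towerOfRecord₁₃Chi (θ : Stage13Params F N) (χ : ChiSlot F N) (h : θ.Provisos₁₃Chi F N χ) : (coreOfRecord₁₃Chi F N θ χ).Tower (avOfRecord F N) where
  ρ := fun p k => densOfRecord₁₃Chi F N θ χ p k
  Trho := fun p k => tdensOfRecord₁₃Chi F N θ χ p k
  rho_zero := fun p => (rhoZero_coreOfRecord₁₃_chi F N θ χ p).symm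
  isRT_Trho := fun p k hk => isRT_trhoOfRecord9 F N θ.ν θ.τ9 (EOfRecord₁₃Chi F N θ χ) (wOfRecord₉ F N θ.toStage9Params) θ.ppSel p
    (gOfRecord₁₃Chi F N θ χ p) k hk (h.tstep p k hk)
  integral_succ := fun p k hk => integral_densOfRecord₁₃_succ_chi F N θ χ p k (h.rstep p k hk)

/-- **THE DATUM OF RECORD, STAGE 13**. [cite: Balaban1989LargeFieldII, Thm 1 + (0.1) pp.355–356; Balaban1988Convergent, (0.2) p.244] -/
def datumOfRecord₁₃Chi (θ : Stage13Params F N) (χ : ChiSlot F N) (h : θ.Provisos₁₃Chi F N χ) : FiniteEpsData F (SU N) :=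
  datumOfTower F N (coreOfRecord₁₃Chi F N θ χ) (towerOfRecord₁₃Chi F N θ χ h)

/-- The tower's densities ARE `densOfRecord₁₃Chi` (`rfl`). [cite: Balaban1988Convergent, (2.18) p.257 (bookkeeping)] -/
theorem towerOfRecord₁₃_ρ_chi (θ : Stage13Params F N) (χ : ChiSlot F N) (h : θ.Provisos₁₃Chi F N χ) (p : B12.RunParams) (k : ℕ) :
    (towerOfRecord₁₃Chi F N θ χ h).ρ p k = densOfRecord₁₃Chi F N θ χ p k := rfl

/-- The tower's `𝐓ρ_k` ARE `tdensOfRecord₁₃Chi` (`rfl`). [cite: Balaban1988Convergent, (3.25) p.270 (bookkeeping)] -/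
theorem towerOfRecord₁₃_Trho_chi (θ : Stage13Params F N) (χ : ChiSlot F N) (h : θ.Provisos₁₃Chi F N χ) (p : B12.RunParams) (k : ℕ) :
    (towerOfRecord₁₃Chi F N θ χ h).Trho p k = tdensOfRecord₁₃Chi F N θ χ p k := rfl

/-- `ρ₀` of the tower is integrable on every run: `e^{−E(p)}` times the Wilson–Boltzmann weight (`Missing.integrable_boltzmann`). [cite: Balaban1988Convergent, Thm 1 p.262 (bookkeeping)] -/
theorem integrable_towerOfRecord₁₃_ρ_zero_chi (θ : Stage13Params F N) (χ : ChiSlot F N) (h : θ.Provisos₁₃Chi F N χ) (p : B12.RunParams) :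
    Integrable ((towerOfRecord₁₃Chi F N θ χ h).ρ p 0) (fieldMeasure (F.P p.K) 0 (SU N)) := by
  rw [(towerOfRecord₁₃Chi F N θ χ h).rho_zero p]
  exact (Missing.integrable_boltzmann RegularGaugeGroup.measurable_reTr (F.P p.K) (sq_nonneg _)).const_mul _

open Classical in
/-- `ρ_{k+1}` of the tower is integrable, `k < K`: the (0.3)-density of the R-stepped pre-𝐑 slot under the integrable-form `rstep` (def-R's
`integrable_densityOfSlice_rstepSlotOfRecord_of_provisosInt`). [cite: Balaban1989LargeFieldI, (0.3)–(0.4) p.176 (bookkeeping)] -/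
theorem integrable_towerOfRecord₁₃_ρ_succ_chi (θ : Stage13Params F N) (χ : ChiSlot F N) (h : θ.Provisos₁₃Chi F N χ) (p : B12.RunParams) (k : ℕ) (hk : k < p.K) :
    Integrable ((towerOfRecord₁₃Chi F N θ χ h).ρ p (k + 1)) (fieldMeasure (F.P p.K) (k + 1) (SU N)) := by
  rw [towerOfRecord₁₃_ρ_chi, densOfRecord₁₃_succ_chi]
  exact integrable_densityOfSlice_rstepSlotOfRecord_of_provisosInt F N θ.ν θ.τ9 _ θ.ppSel p _ (k + 1) (h.rstep p k hk)

/-- **THE TOWER OF RECORD IS INTEGRABLE** (`RGMachineCore.Tower.IsIntegrable`): every `ρ_k`, `k ≤ K`, from the displayed provisos alone. [cite: Balaban1988Convergent, (0.2) p.244 (bookkeeping)] -/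
theorem isIntegrable_towerOfRecord₁₃_chi (θ : Stage13Params F N) (χ : ChiSlot F N) (h : θ.Provisos₁₃Chi F N χ) : (towerOfRecord₁₃Chi F N θ χ h).IsIntegrable
  | p, 0, _ => integrable_towerOfRecord₁₃_ρ_zero_chi F N θ χ h p
  | p, k + 1, hk => integrable_towerOfRecord₁₃_ρ_succ_chi F N θ χ h p k (Nat.lt_of_succ_le hk)

/-- … and every `𝐓ρ_k`, `k < K`, is integrable (def-T's `integrable_piece_trhoOfRecord9` summed). [cite: Balaban1988Convergent, (3.25) p.270 (bookkeeping)] -/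
theorem integrable_towerOfRecord₁₃_Trho_chi (θ : Stage13Params F N) (χ : ChiSlot F N) (h : θ.Provisos₁₃Chi F N χ) (p : B12.RunParams) (k : ℕ) (hk : k < p.K) :
    Integrable ((towerOfRecord₁₃Chi F N θ χ h).Trho p k) (fieldMeasure (F.P p.K) (k + 1) (SU N)) :=
  integrable_finsetSum Finset.univ (fun s' _ => integrable_piece_trhoOfRecord9 F N θ.ν θ.τ9 (EOfRecord₁₃Chi F N θ χ) (wOfRecord₉ F N θ.toStage9Params)
    θ.ppSel p (gOfRecord₁₃Chi F N θ χ p) k hk (h.tstep p k hk) s')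

/-- FACE `dens` (`rfl`). [cite: Balaban1988Convergent, (2.18) p.257 (bookkeeping)] -/
theorem dens_datumOfRecord₁₃_chi (θ : Stage13Params F N) (χ : ChiSlot F N) (h : θ.Provisos₁₃Chi F N χ) (K : ℕ) (g₀ : ℝ) (k : ℕ) :
    (datumOfRecord₁₃Chi F N θ χ h).dens K g₀ k = densOfRecord₁₃Chi F N θ χ ⟨K, F.m, g₀⟩ k := rfl

/-- FACE `Trho` (`rfl`). [cite: Balaban1988Convergent, (3.25) p.270 (bookkeeping)] -/
theorem trho_datumOfRecord₁₃_chi (θ : Stage13Params F N) (χ : ChiSlot F N) (h : θ.Provisos₁₃Chi F N χ) (K : ℕ) (g₀ : ℝ) (k : ℕ) :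
    (datumOfRecord₁₃Chi F N θ χ h).real.Trho K g₀ k = tdensOfRecord₁₃Chi F N θ χ ⟨K, F.m, g₀⟩ k := rfl

/-- FACE `𝐑` (`rfl`). [cite: Balaban1989LargeFieldI, (0.2)–(0.3) p.176 (bookkeeping)] -/
theorem R_datumOfRecord₁₃_eq_VOfRecord₁₃_chi (θ : Stage13Params F N) (χ : ChiSlot F N) (h : θ.Provisos₁₃Chi F N χ) (K : ℕ) (g₀ : ℝ) (k : ℕ) :
    (datumOfRecord₁₃Chi F N θ χ h).real.R K g₀ k = (VOfRecord₁₃Chi F N θ χ ⟨K, F.m, g₀⟩).R k := rfl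

/-- … and maps `𝐓ρ_k ↦ ρ_{k+1}`. [cite: Balaban1988Convergent, (0.2) p.244; Balaban1989LargeFieldI, (0.3) p.176] -/
theorem R_tdens_datumOfRecord₁₃_chi (θ : Stage13Params F N) (χ : ChiSlot F N) (h : θ.Provisos₁₃Chi F N χ) (K : ℕ) (g₀ : ℝ) (k : ℕ) :
    (datumOfRecord₁₃Chi F N θ χ h).real.R K g₀ k (tdensOfRecord₁₃Chi F N θ χ ⟨K, F.m, g₀⟩ k) =
      densOfRecord₁₃Chi F N θ χ ⟨K, F.m, g₀⟩ (k + 1) :=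
  (towerOfRecord₁₃Chi F N θ χ h).inducedR_Trho ⟨K, F.m, g₀⟩ k

/-- FACE construction (`rfl`). [cite: Balaban1989LargeFieldII, Thm 1 + (0.1) pp.355–356 (bookkeeping)] -/
theorem datumOfRecord₁₃_C_chi (θ : Stage13Params F N) (χ : ChiSlot F N) (h : θ.Provisos₁₃Chi F N χ) :
    (datumOfRecord₁₃Chi F N θ χ h).C = (coreOfRecord₁₃Chi F N θ χ).construction (densOfRecord₁₃Chi F N θ χ) := rfl

/-- FACE β: the datum's β-functions ARE `betaOfRecord₁₃ θ` (`rfl`). [cite: Balaban1987RG1, (1.20)–(1.22) p.264 (bookkeeping)] -/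
theorem βfun_datumOfRecord₁₃_chi (θ : Stage13Params F N) (χ : ChiSlot F N) (h : θ.Provisos₁₃Chi F N χ) :
    (datumOfRecord₁₃Chi F N θ χ h).βfun = betaOfRecord₁₃Chi F N θ χ := rfl

/-- … i.e. the χ-generic β at `T := TcanOfRecord`, `χ := chiFixed29 θ.ν θ.ε₂₉` (`rfl`). [cite: Balaban1987RG1, (1.20)–(1.22) p.264, (2.9) p.266 (bookkeeping)] -/
theorem βfun_datumOfRecord₁₃_eq_betaOfRecord₈Tχ_chi (θ : Stage13Params F N) (χ : ChiSlot F N) (h : θ.Provisos₁₃Chi F N χ) :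
    (datumOfRecord₁₃Chi F N θ χ h).βfun = betaOfRecord₈Tχ F N (TcanOfRecord F N) χ θ.toStage8Params := rfl

/-- FACE flow (`rfl`). [cite: Balaban1987RG1, (0.17)–(0.20) pp.255–256 (bookkeeping)] -/
theorem flow_g_datumOfRecord₁₃_chi (θ : Stage13Params F N) (χ : ChiSlot F N) (h : θ.Provisos₁₃Chi F N χ) (p : B12.RunParams) :
    ((datumOfRecord₁₃Chi F N θ χ h).C p).flow.g = gOfRecord₁₃Chi F N θ χ p := rfl

/-- FACE av (`rfl`). [cite: Balaban1987RG1, (0.4) p.253 (bookkeeping)] -/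
theorem av_datumOfRecord₁₃_chi (θ : Stage13Params F N) (χ : ChiSlot F N) (h : θ.Provisos₁₃Chi F N χ) : (datumOfRecord₁₃Chi F N θ χ h).av = avOfRecord F N := rfl

/-- STAGE-0 DATUM CLAUSE at the Stage-13 datum (`rfl`). [cite: Balaban1987RG1, (0.3)–(0.4) p.253] -/
theorem isDatumOfRecord₀_datumOfRecord₁₃_chi (θ : Stage13Params F N) (χ : ChiSlot F N) (h : θ.Provisos₁₃Chi F N χ) : IsDatumOfRecord₀ F N (datumOfRecord₁₃Chi F N θ χ h) := rfl

/-- BINDER B1 = NODE N23 at the Stage-13 datum. [cite: Balaban1987RG1, (0.4) p.253] -/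
theorem isPrintedAveraged_datumOfRecord₁₃_chi (θ : Stage13Params F N) (χ : ChiSlot F N) (h : θ.Provisos₁₃Chi F N χ) : (datumOfRecord₁₃Chi F N θ χ h).IsPrintedAveraged :=
  isPrintedAveraged_datumOfTower F N _ _

/-! ## §R. RECEIPTS: the record IS the instance `χ := chiβOfRecord₁₃ θ`, definitionally (defs: `rfl`; Prop-structures: field-wise `Iff`) -/

section Receipts
variable {F N}
variable (θ : Stage13Params F N)

/-- Receipt: `betaOfRecord₁₃Chi_chiβ` — the χ-generic re-issue at the record's own β-slot IS the record's object (definitional). [cite: Balaban1987RG1, (1.20)–(1.22) p.264 and (2.9) p.266 (bookkeeping)] -/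
theorem betaOfRecord₁₃Chi_chiβ : betaOfRecord₁₃Chi F N θ (chiβOfRecord₁₃ F N θ) = betaOfRecord₁₃ F N θ := rfl
/-- Receipt: `gOfRecord₁₃Chi_chiβ` — the χ-generic re-issue at the record's own β-slot IS the record's object (definitional). [cite: Balaban1987RG1, (1.20)–(1.22) p.264 and (2.9) p.266 (bookkeeping)] -/
theorem gOfRecord₁₃Chi_chiβ : gOfRecord₁₃Chi F N θ (chiβOfRecord₁₃ F N θ) = gOfRecord₁₃ F N θ := rfl
/-- Receipt: `EOfRecord₁₃Chi_chiβ` — the χ-generic re-issue at the record's own β-slot IS the record's object (definitional). [cite: Balaban1987RG1, (1.20)–(1.22) p.264 and (2.9) p.266 (bookkeeping)] -/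
theorem EOfRecord₁₃Chi_chiβ : EOfRecord₁₃Chi F N θ (chiβOfRecord₁₃ F N θ) = EOfRecord₁₃ F N θ := rfl
/-- Receipt: `reprOfRecord₁₃Chi_chiβ` — the χ-generic re-issue at the record's own β-slot IS the record's object (definitional). [cite: Balaban1987RG1, (1.20)–(1.22) p.264 and (2.9) p.266 (bookkeeping)] -/
theorem reprOfRecord₁₃Chi_chiβ : reprOfRecord₁₃Chi F N θ (chiβOfRecord₁₃ F N θ) = reprOfRecord₁₃ F N θ := rfl
/-- Receipt: `reprTOfRecord₁₃Chi_chiβ` — the χ-generic re-issue at the record's own β-slot IS the record's object (definitional). [cite: Balaban1987RG1, (1.20)–(1.22) p.264 and (2.9) p.266 (bookkeeping)] -/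
theorem reprTOfRecord₁₃Chi_chiβ : reprTOfRecord₁₃Chi F N θ (chiβOfRecord₁₃ F N θ) = reprTOfRecord₁₃ F N θ := rfl
/-- Receipt: `densOfRecord₁₃Chi_chiβ` — the χ-generic re-issue at the record's own β-slot IS the record's object (definitional). [cite: Balaban1987RG1, (1.20)–(1.22) p.264 and (2.9) p.266 (bookkeeping)] -/
theorem densOfRecord₁₃Chi_chiβ : densOfRecord₁₃Chi F N θ (chiβOfRecord₁₃ F N θ) = densOfRecord₁₃ F N θ := rfl
/-- Receipt: `tdensOfRecord₁₃Chi_chiβ` — the χ-generic re-issue at the record's own β-slot IS the record's object (definitional). [cite: Balaban1987RG1, (1.20)–(1.22) p.264 and (2.9) p.266 (bookkeeping)] -/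
theorem tdensOfRecord₁₃Chi_chiβ : tdensOfRecord₁₃Chi F N θ (chiβOfRecord₁₃ F N θ) = tdensOfRecord₁₃ F N θ := rfl
/-- Receipt: `WtOfRecord₁₃Chi_chiβ` — the χ-generic re-issue at the record's own β-slot IS the record's object (definitional). [cite: Balaban1987RG1, (1.20)–(1.22) p.264 and (2.9) p.266 (bookkeeping)] -/
theorem WtOfRecord₁₃Chi_chiβ : WtOfRecord₁₃Chi F N θ (chiβOfRecord₁₃ F N θ) = WtOfRecord₁₃ F N θ := rfl
/-- Receipt: `settingOfRecord₁₃Chi_chiβ` — the χ-generic re-issue at the record's own β-slot IS the record's object (definitional). [cite: Balaban1987RG1, (1.20)–(1.22) p.264 and (2.9) p.266 (bookkeeping)] -/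
theorem settingOfRecord₁₃Chi_chiβ : settingOfRecord₁₃Chi F N θ (chiβOfRecord₁₃ F N θ) = settingOfRecord₁₃ F N θ := rfl
/-- Receipt: `UbgOfRecord₁₃Chi_chiβ` — the χ-generic re-issue at the record's own β-slot IS the record's object (definitional). [cite: Balaban1987RG1, (1.20)–(1.22) p.264 and (2.9) p.266 (bookkeeping)] -/
theorem UbgOfRecord₁₃Chi_chiβ : UbgOfRecord₁₃Chi F N θ (chiβOfRecord₁₃ F N θ) = UbgOfRecord₁₃ F N θ := rfl
/-- Receipt: `suppOfRecord₁₃Chi_chiβ` — the χ-generic re-issue at the record's own β-slot IS the record's object (definitional). [cite: Balaban1987RG1, (1.20)–(1.22) p.264 and (2.9) p.266 (bookkeeping)] -/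
theorem suppOfRecord₁₃Chi_chiβ : suppOfRecord₁₃Chi F N θ (chiβOfRecord₁₃ F N θ) = suppOfRecord₁₃ F N θ := rfl
/-- Receipt: `S218OfRecord₁₃Chi_chiβ` — the χ-generic re-issue at the record's own β-slot IS the record's object (definitional). [cite: Balaban1987RG1, (1.20)–(1.22) p.264 and (2.9) p.266 (bookkeeping)] -/
theorem S218OfRecord₁₃Chi_chiβ : S218OfRecord₁₃Chi F N θ (chiβOfRecord₁₃ F N θ) = S218OfRecord₁₃ F N θ := rfl
/-- Receipt: `ScorrLawOfRecord₁₃Chi_chiβ` — the χ-generic re-issue at the record's own β-slot IS the record's object (definitional). [cite: Balaban1987RG1, (1.20)–(1.22) p.264 and (2.9) p.266 (bookkeeping)] -/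
theorem ScorrLawOfRecord₁₃Chi_chiβ : ScorrLawOfRecord₁₃Chi F N θ (chiβOfRecord₁₃ F N θ) = ScorrLawOfRecord₁₃ F N θ := rfl
/-- Receipt: `SLaw₁₃Chi_chiβ` — the χ-generic re-issue at the record's own β-slot IS the record's object (definitional). [cite: Balaban1987RG1, (1.20)–(1.22) p.264 and (2.9) p.266 (bookkeeping)] -/
theorem SLaw₁₃Chi_chiβ : SLaw₁₃Chi F N θ (chiβOfRecord₁₃ F N θ) = SLaw₁₃ F N θ := rfl
/-- Receipt: `TLaw₁₃Chi_chiβ` — the χ-generic re-issue at the record's own β-slot IS the record's object (definitional). [cite: Balaban1987RG1, (1.20)–(1.22) p.264 and (2.9) p.266 (bookkeeping)] -/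
theorem TLaw₁₃Chi_chiβ : TLaw₁₃Chi F N θ (chiβOfRecord₁₃ F N θ) = TLaw₁₃ F N θ := rfl
/-- Receipt: `VOfRecord₁₃Chi_chiβ` — the χ-generic re-issue at the record's own β-slot IS the record's object (definitional). [cite: Balaban1987RG1, (1.20)–(1.22) p.264 and (2.9) p.266 (bookkeeping)] -/
theorem VOfRecord₁₃Chi_chiβ : VOfRecord₁₃Chi F N θ (chiβOfRecord₁₃ F N θ) = VOfRecord₁₃ F N θ := rfl
/-- Receipt: `residualOfStage13Chi_chiβ` — the χ-generic re-issue at the record's own β-slot IS the record's object (definitional). [cite: Balaban1987RG1, (1.20)–(1.22) p.264 and (2.9) p.266 (bookkeeping)] -/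
theorem residualOfStage13Chi_chiβ : residualOfStage13Chi F N θ (chiβOfRecord₁₃ F N θ) = residualOfStage13 F N θ := rfl
/-- Receipt: `toStage5₁₃Chi_chiβ` — the χ-generic re-issue at the record's own β-slot IS the record's object (definitional). [cite: Balaban1987RG1, (1.20)–(1.22) p.264 and (2.9) p.266 (bookkeeping)] -/
theorem toStage5₁₃Chi_chiβ : θ.toStage5₁₃Chi F N (chiβOfRecord₁₃ F N θ) = θ.toStage5₁₃ F N := rfl
/-- Receipt: `coreOfRecord₁₃Chi_chiβ` — the χ-generic re-issue at the record's own β-slot IS the record's object (definitional). [cite: Balaban1987RG1, (1.20)–(1.22) p.264 and (2.9) p.266 (bookkeeping)] -/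
theorem coreOfRecord₁₃Chi_chiβ : coreOfRecord₁₃Chi F N θ (chiβOfRecord₁₃ F N θ) = coreOfRecord₁₃ F N θ := rfl
/-- Receipt: `slotsNondegenerate₁₃Chi_chiβ_iff` — the χ-generic re-issue at the record's own β-slot IS the record's object (definitional). [cite: Balaban1987RG1, (1.20)–(1.22) p.264 and (2.9) p.266 (bookkeeping)] -/
theorem slotsNondegenerate₁₃Chi_chiβ_iff : θ.SlotsNondegenerate₁₃Chi F N (chiβOfRecord₁₃ F N θ) ↔ θ.SlotsNondegenerate₁₃ F N := Iff.rfl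

/-- The χ-generic provisos AT THE RECORD's χ are the record's provisos, field for field. [cite: Balaban1988Convergent, (2.18) p.257 (bookkeeping)] -/
theorem provisos₁₃Chi_chiβ_iff : θ.Provisos₁₃Chi F N (chiβOfRecord₁₃ F N θ) ↔ θ.Provisos₁₃ F N :=
  ⟨fun h => ⟨h.intPiece, h.measω, h.measChi, h.zetaUnity, h.zetaAbs, h.rstep, h.rzLaws, h.ztLaws, h.ztLocal, h.bg, h.zetaMeas⟩,
   fun h => ⟨h.intPiece, h.measω, h.measChi, h.zetaUnity, h.zetaAbs, h.rstep, h.rzLaws, h.ztLaws, h.ztLocal, h.bg, h.zetaMeas⟩⟩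

/-- The χ-generic tower∕datum AT THE RECORD's χ are the record's tower∕datum (data fields `ρ`, `Trho` agree definitionally). [cite: Balaban1988Convergent, Thm 1 p.262 (bookkeeping)] -/
theorem datumOfRecord₁₃Chi_chiβ (h : θ.Provisos₁₃ F N) :
    datumOfRecord₁₃Chi F N θ (chiβOfRecord₁₃ F N θ) ((provisos₁₃Chi_chiβ_iff θ).2 h) = datumOfRecord₁₃ F N θ h := rfl

end Receipts

/-! ## §A. THE RE-CENTRED RECORD = the instance `χ := chiβOfRecord₁₃Ax θ` ([Ax-2]∕[Ax-3a]) -/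

section Ax
variable {F N}
variable (θ : Stage13Params F N)

/-- `betaOfRecord₁₃Ax` ([Ax-3a]) IS the χ-generic β at the re-centred cut-off (`rfl`). [cite: Balaban1987RG1, (1.20)–(1.22) p.264, (2.9) p.266] -/
theorem betaOfRecord₁₃Chi_chiβAx : betaOfRecord₁₃Chi F N θ (chiβOfRecord₁₃Ax F N θ) = betaOfRecord₁₃Ax F N θ := rfl

end Ax

/-- **THE GENERATED HISTORY of the run `p`, RE-CENTRED**: `g_k := genSeq β₁₃ᴬˣ g₀ k`. [cite: Balaban1987RG1, (0.17)–(0.20) pp.255–256] -/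
abbrev gOfRecord₁₃Ax (θ : Stage13Params F N) (p : B12.RunParams) : ℕ → ℝ := gOfRecord₁₃Chi F N θ (chiβOfRecord₁₃Ax F N θ) p

/-- The normalisation `E(p)`, RE-CENTRED. [cite: Balaban1988Convergent, (1.15) p.249 (bookkeeping)] -/
abbrev EOfRecord₁₃Ax (θ : Stage13Params F N) : B12.RunParams → ℝ := EOfRecord₁₃Chi F N θ (chiβOfRecord₁₃Ax F N θ)

/-- **The Stage-13 provisos, RE-CENTRED** = the χ-generic provisos at `χ := chiβOfRecord₁₃Ax θ`. [cite: Balaban1988Convergent, (2.18) p.257, Thm 1 p.262] -/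
abbrev Stage13Params.Provisos₁₃Ax (θ : Stage13Params F N) : Prop := θ.Provisos₁₃Chi F N (chiβOfRecord₁₃Ax F N θ)

/-- **The datum of record, RE-CENTRED**. [cite: Balaban1988Convergent, Thm 1 p.262] -/
abbrev datumOfRecord₁₃Ax (θ : Stage13Params F N) (h : θ.Provisos₁₃Ax F N) : FiniteEpsData F (SU N) :=
  datumOfRecord₁₃Chi F N θ (chiβOfRecord₁₃Ax F N θ) h

/-- **The slot non-degeneracy guard of record, RE-CENTRED** (`χ := chiβOfRecord₁₃Ax θ`; v2 append 2026-08-31, TYPER-1 [Ax-3d] SPELLING ASK: declared in the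
SAME namespace as `Stage13Params.SlotsNondegenerate₁₃`, so the K-texts' dot-notation needle `θ.SlotsNondegenerate₁₃ F 2 ↦ θ.SlotsNondegenerate₁₃Ax F 2` on
`θ : Stage13HParams F 2` resolves through `extends`).  A HYPOTHESIS-shaped guard on runs, never asserted. [cite: Balaban1988Convergent, (3.22) p.269; Balaban1989LargeFieldI, (0.3) p.176] -/
abbrev Stage13Params.SlotsNondegenerate₁₃Ax (θ : Stage13Params F N) : Prop :=
  θ.SlotsNondegenerate₁₃Chi F N (chiβOfRecord₁₃Ax F N θ)

/-- Unfolding of the re-centred guard (`Iff.rfl`). [cite: Balaban1988Convergent, (3.22) p.269 (bookkeeping)] -/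
theorem Stage13Params.slotsNondegenerate₁₃Ax_iff (θ : Stage13Params F N) :
    θ.SlotsNondegenerate₁₃Ax F N ↔ θ.SlotsNondegenerate₁₃Chi F N (chiβOfRecord₁₃Ax F N θ) := Iff.rfl

end Literature.MathematicalPhysics.QuantumFieldTheory.Balaban1983to89.Node00

end
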